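import Mathlib
import Summits.Ventures.PercRepro2.SwOutMixedArmsBaseDefs

/-!
# The several-arms base: the classes are disjoint and the realisation on each class (blind cell
PercRepro2, night-4 g20, 2026-08-27; proofs/NIGHT4-G20.md §4′)

For a `MixedBaseR`: which vertices an edge touching a u-arm, a piece or a far arm can join
(`ends_of_touches_U` / `_Ah` / `_F`), the pairwise disjointness of the edge classes, that a u–`p r`
edge and an outside edge of `p r` touch no arm, and the value of the realisation `mixedRealR σ q`
on each class: the base value when the class's coordinate is `true`, the flipped value when it is
`false` (`mixedRealR_apply_U` / `_Ah` / `_UP` / `_Ext` / `_F`), and the base value off every class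
(`mixedRealR_apply_none`).  The single-arm twins are in `SwOutMixedBaseClasses`.
-/

namespace Summit.Ventures.PercRepro2

namespace MixedArms

open Hull LocRows

variable {V : Type*} {E : Type*}

open scoped Classical

section Base

variable {ends : E → Sym2 V} {σ : Config E} {h u : V} {ι ρ ν κ : Type*} {U : ι → Set V}
  {p : ρ → V} {Ah : ν → Set V} {arm : ν → ρ} {F : κ → Set V}
  (hb : MixedBaseR ends σ h u U p Ah arm F)
include hb

/-! ### Which vertices the edges at `u` and at `p r` can join -/

/-- A piece is not joined to `u`. -/
lemma MixedBaseR.no_uAh {e : E} {x : V} (he : ends e = s(u, x)) (i : ν) : x ∉ Ah i := by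
  intro hx
  rcases hb.u_edges e x he with ⟨j, hj⟩ | ⟨r, rfl⟩
  · exact hb.U_disj_Ah j i x hj hx
  · exact hb.p_notMem_Ah r i hx

/-- A far arm is not joined to `u`. -/
lemma MixedBaseR.no_uF {e : E} {x : V} (he : ends e = s(u, x)) (k : κ) : x ∉ F k := by
  intro hx
  rcases hb.u_edges e x he with ⟨j, hj⟩ | ⟨r, rfl⟩
  · exact hb.U_disj_F j k x hj hx
  · exact hb.p_notMem_F r k hx

/-- A u-arm is not joined to a dropped vertex. -/
lemma MixedBaseR.no_pU {r : ρ} {e : E} {x : V} (he : ends e = s(p r, x)) (j : ι) : x ∉ U j := by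
  intro hx
  rcases hb.p_edges r e x he with rfl | ⟨i, -, hx'⟩ | ⟨-, -, hx'⟩
  · exact hb.u_notMem_U j hx
  · exact hb.U_disj_Ah j i x hx hx'
  · exact hx' (Or.inl (Or.inl (Set.mem_iUnion.2 ⟨j, hx⟩)))

/-- A far arm is not joined to a dropped vertex. -/
lemma MixedBaseR.no_pF {r : ρ} {e : E} {x : V} (he : ends e = s(p r, x)) (k : κ) : x ∉ F k := by
  intro hx
  rcases hb.p_edges r e x he with rfl | ⟨i, -, hx'⟩ | ⟨-, -, hx'⟩
  · exact hb.u_notMem_F k hx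
  · exact hb.Ah_disj_F i k x hx' hx
  · exact hx' (Or.inr (Set.mem_iUnion.2 ⟨k, hx⟩))

/-- An edge touching `U j` has an end in `U j` and the other end in `U j`, at `h`, at `u`, or
outside everything. -/
lemma MixedBaseR.ends_of_touches_U {j : ι} {e : E} (he : e ∈ touches ends (U j)) :
    ∃ x y, ends e = s(x, y) ∧ x ∈ U j ∧
      (y ∈ U j ∨ y = h ∨ y = u ∨ (y ≠ h ∧ y ≠ u ∧ (∀ r, y ≠ p r) ∧ y ∉ armsAllR U Ah F)) := by
  obtain ⟨x, hx, y, hxy⟩ := he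
  refine ⟨x, y, hxy, hx, ?_⟩
  by_cases hyU : y ∈ U j
  · exact Or.inl hyU
  by_cases hyh : y = h
  · exact Or.inr (Or.inl hyh)
  by_cases hyu : y = u
  · exact Or.inr (Or.inr (Or.inl hyu))
  refine Or.inr (Or.inr (Or.inr ⟨hyh, hyu, fun r hr => ?_, fun hy => ?_⟩))
  · rw [hr] at hxy
    exact hb.no_pU (ends_swap hxy) j hx
  · rcases hy with (hy | hy) | hy
    · obtain ⟨j', hj'⟩ := Set.mem_iUnion.1 hy
      have hne : j ≠ j' := by
        rintro rfl
        exact hyU hj'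
      exact hb.no_cross_UU j j' hne e x y hxy hx hj'
    · obtain ⟨i, hi⟩ := Set.mem_iUnion.1 hy
      exact hb.no_cross_UAh j i e x y hxy hx hi
    · obtain ⟨k, hk⟩ := Set.mem_iUnion.1 hy
      exact hb.no_cross_UF j k e x y hxy hx hk

/-- An edge touching a piece `Ah i` has an end in `Ah i` and the other end in `Ah i`, at `h`, at
`p (arm i)`, or outside everything. -/
lemma MixedBaseR.ends_of_touches_Ah {i : ν} {e : E} (he : e ∈ touches ends (Ah i)) :
    ∃ x y, ends e = s(x, y) ∧ x ∈ Ah i ∧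
      (y ∈ Ah i ∨ y = h ∨ y = p (arm i) ∨
        (y ≠ h ∧ y ≠ u ∧ (∀ r, y ≠ p r) ∧ y ∉ armsAllR U Ah F)) := by
  obtain ⟨x, hx, y, hxy⟩ := he
  refine ⟨x, y, hxy, hx, ?_⟩
  by_cases hyA : y ∈ Ah i
  · exact Or.inl hyA
  by_cases hyh : y = h
  · exact Or.inr (Or.inl hyh)
  by_cases hyp : ∃ r, y = p r
  · obtain ⟨r, rfl⟩ := hyp
    have := hb.arm_of_dead (ends_swap hxy) hx
    rw [this]
    exact Or.inr (Or.inr (Or.inl rfl))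
  have hyp' : ∀ r, y ≠ p r := fun r hr => hyp ⟨r, hr⟩
  refine Or.inr (Or.inr (Or.inr ⟨hyh, fun hyu => ?_, hyp', fun hy => ?_⟩))
  · rw [hyu] at hxy
    exact hb.no_uAh (ends_swap hxy) i hx
  · rcases hy with (hy | hy) | hy
    · obtain ⟨j, hj⟩ := Set.mem_iUnion.1 hy
      exact hb.no_cross_UAh j i e y x (ends_swap hxy) hj hx
    · obtain ⟨i', hi'⟩ := Set.mem_iUnion.1 hy
      have hne : i ≠ i' := by
        rintro rfl
        exact hyA hi'
      exact hb.no_cross_AhAh i i' hne e x y hxy hx hi'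
    · obtain ⟨k, hk⟩ := Set.mem_iUnion.1 hy
      exact hb.no_cross_AhF i k e x y hxy hx hk

/-- An edge touching `F k` has an end in `F k` and the other end in `F k`, at `h`, or outside
everything. -/
lemma MixedBaseR.ends_of_touches_F {k : κ} {e : E} (he : e ∈ touches ends (F k)) :
    ∃ x y, ends e = s(x, y) ∧ x ∈ F k ∧
      (y ∈ F k ∨ y = h ∨ (y ≠ h ∧ y ≠ u ∧ (∀ r, y ≠ p r) ∧ y ∉ armsAllR U Ah F)) := by
  obtain ⟨x, hx, y, hxy⟩ := he
  refine ⟨x, y, hxy, hx, ?_⟩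
  by_cases hyF : y ∈ F k
  · exact Or.inl hyF
  by_cases hyh : y = h
  · exact Or.inr (Or.inl hyh)
  refine Or.inr (Or.inr ⟨hyh, fun hyu => ?_, fun r hr => ?_, fun hy => ?_⟩)
  · rw [hyu] at hxy
    exact hb.no_uF (ends_swap hxy) k hx
  · rw [hr] at hxy
    exact hb.no_pF (ends_swap hxy) k hx
  · rcases hy with (hy | hy) | hy
    · obtain ⟨j, hj⟩ := Set.mem_iUnion.1 hy
      exact hb.no_cross_UF j k e y x (ends_swap hxy) hj hx
    · obtain ⟨i, hi⟩ := Set.mem_iUnion.1 hy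
      exact hb.no_cross_AhF i k e y x (ends_swap hxy) hi hx
    · obtain ⟨k', hk'⟩ := Set.mem_iUnion.1 hy
      have hne : k ≠ k' := by
        rintro rfl
        exact hyF hk'
      exact hb.no_cross_FF k k' hne e x y hxy hx hk'

/-! ### Disjointness of the classes -/

/-- The classes `touches (U j)` are pairwise disjoint. -/
lemma MixedBaseR.touches_U_disj {j j' : ι} (hne : j ≠ j') {e : E} (he : e ∈ touches ends (U j)) :
    e ∉ touches ends (U j') := by
  intro he'
  obtain ⟨x, y, hxy, hx, _⟩ := hb.ends_of_touches_U he
  obtain ⟨x', hx', y', hxy'⟩ := he'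
  rw [hxy, Sym2.eq_iff] at hxy'
  rcases hxy' with ⟨h1, _⟩ | ⟨_, h2⟩
  · rw [← h1] at hx'
    exact hb.U_disj j j' hne x hx hx'
  · rw [← h2] at hx'
    exact hb.no_cross_UU j j' hne e x y hxy hx hx'

/-- `touches (U j)` and `touches (Ah i)` are disjoint. -/
lemma MixedBaseR.touches_U_Ah_disj {j : ι} {i : ν} {e : E} (he : e ∈ touches ends (U j)) :
    e ∉ touches ends (Ah i) := by
  intro he'
  obtain ⟨x, y, hxy, hx, _⟩ := hb.ends_of_touches_U he
  obtain ⟨x', hx', y', hxy'⟩ := he'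
  rw [hxy, Sym2.eq_iff] at hxy'
  rcases hxy' with ⟨h1, _⟩ | ⟨_, h2⟩
  · rw [← h1] at hx'
    exact hb.U_disj_Ah j i x hx hx'
  · rw [← h2] at hx'
    exact hb.no_cross_UAh j i e x y hxy hx hx'

/-- `touches (U j)` and `touches (F k)` are disjoint. -/
lemma MixedBaseR.touches_U_F_disj {j : ι} {k : κ} {e : E} (he : e ∈ touches ends (U j)) :
    e ∉ touches ends (F k) := by
  intro he'
  obtain ⟨x, y, hxy, hx, _⟩ := hb.ends_of_touches_U he
  obtain ⟨x', hx', y', hxy'⟩ := he'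
  rw [hxy, Sym2.eq_iff] at hxy'
  rcases hxy' with ⟨h1, _⟩ | ⟨_, h2⟩
  · rw [← h1] at hx'
    exact hb.U_disj_F j k x hx hx'
  · rw [← h2] at hx'
    exact hb.no_cross_UF j k e x y hxy hx hx'

/-- The classes `touches (Ah i)` are pairwise disjoint. -/
lemma MixedBaseR.touches_Ah_disj {i i' : ν} (hne : i ≠ i') {e : E}
    (he : e ∈ touches ends (Ah i)) : e ∉ touches ends (Ah i') := by
  intro he'
  obtain ⟨x, y, hxy, hx, _⟩ := hb.ends_of_touches_Ah he
  obtain ⟨x', hx', y', hxy'⟩ := he'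
  rw [hxy, Sym2.eq_iff] at hxy'
  rcases hxy' with ⟨h1, _⟩ | ⟨_, h2⟩
  · rw [← h1] at hx'
    exact hb.Ah_disj i i' hne x hx hx'
  · rw [← h2] at hx'
    exact hb.no_cross_AhAh i i' hne e x y hxy hx hx'

/-- `touches (Ah i)` and `touches (F k)` are disjoint. -/
lemma MixedBaseR.touches_Ah_F_disj {i : ν} {k : κ} {e : E} (he : e ∈ touches ends (Ah i)) :
    e ∉ touches ends (F k) := by
  intro he'
  obtain ⟨x, y, hxy, hx, _⟩ := hb.ends_of_touches_Ah he
  obtain ⟨x', hx', y', hxy'⟩ := he'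
  rw [hxy, Sym2.eq_iff] at hxy'
  rcases hxy' with ⟨h1, _⟩ | ⟨_, h2⟩
  · rw [← h1] at hx'
    exact hb.Ah_disj_F i k x hx hx'
  · rw [← h2] at hx'
    exact hb.no_cross_AhF i k e x y hxy hx hx'

/-- The classes `touches (F k)` are pairwise disjoint. -/
lemma MixedBaseR.touches_F_disj {k k' : κ} (hne : k ≠ k') {e : E} (he : e ∈ touches ends (F k)) :
    e ∉ touches ends (F k') := by
  intro he'
  obtain ⟨x, y, hxy, hx, _⟩ := hb.ends_of_touches_F he
  obtain ⟨x', hx', y', hxy'⟩ := he'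
  rw [hxy, Sym2.eq_iff] at hxy'
  rcases hxy' with ⟨h1, _⟩ | ⟨_, h2⟩
  · rw [← h1] at hx'
    exact hb.F_disj k k' hne x hx hx'
  · rw [← h2] at hx'
    exact hb.no_cross_FF k k' hne e x y hxy hx hx'

/-- A u–`p r` edge touches no arm and is no other arm's u-edge. -/
lemma MixedBaseR.clsUPR_not_touches {r : ρ} {e : E} (he : e ∈ clsUPR ends u p r) :
    (∀ j, e ∉ touches ends (U j)) ∧ (∀ i, e ∉ touches ends (Ah i)) ∧
      (∀ k, e ∉ touches ends (F k)) ∧ ∀ r', r' ≠ r → e ∉ clsUPR ends u p r' := by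
  have hup : ends e = s(u, p r) := he
  refine ⟨fun j hj => ?_, fun i hA => ?_, fun k hk => ?_, fun r' hr' he' => ?_⟩
  · obtain ⟨x, hx, y, hxy⟩ := hj
    rw [hup, Sym2.eq_iff] at hxy
    rcases hxy with ⟨h1, _⟩ | ⟨_, h2⟩
    · rw [← h1] at hx
      exact hb.u_notMem_U j hx
    · rw [← h2] at hx
      exact hb.p_notMem_U r j hx
  · obtain ⟨x, hx, y, hxy⟩ := hA
    rw [hup, Sym2.eq_iff] at hxy
    rcases hxy with ⟨h1, _⟩ | ⟨_, h2⟩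
    · rw [← h1] at hx
      exact hb.u_notMem_Ah i hx
    · rw [← h2] at hx
      exact hb.p_notMem_Ah r i hx
  · obtain ⟨x, hx, y, hxy⟩ := hk
    rw [hup, Sym2.eq_iff] at hxy
    rcases hxy with ⟨h1, _⟩ | ⟨_, h2⟩
    · rw [← h1] at hx
      exact hb.u_notMem_F k hx
    · rw [← h2] at hx
      exact hb.p_notMem_F r k hx
  · have hup' : ends e = s(u, p r') := he'
    rw [hup, Sym2.eq_iff] at hup'
    rcases hup' with ⟨-, h2⟩ | ⟨h1, -⟩
    · exact hr' (hb.p_inj h2.symm)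
    · exact hb.hne_up r' h1

/-- An outside edge of `p r` touches no arm, is no u–p edge and is no other dropped vertex's
outside edge. -/
lemma MixedBaseR.clsExtR_not_touches {r : ρ} {e : E} (he : e ∈ clsExtR ends u p Ah r) :
    (∀ j, e ∉ touches ends (U j)) ∧ (∀ i, e ∉ touches ends (Ah i)) ∧
      (∀ k, e ∉ touches ends (F k)) ∧ (∀ r', e ∉ clsUPR ends u p r') ∧
      ∀ r', r' ≠ r → e ∉ clsExtR ends u p Ah r' := by
  obtain ⟨z, hpz, hzu, hzA⟩ := he
  have hz := hb.p_edges r e z hpz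
  rcases hz with rfl | ⟨i, -, hz⟩ | ⟨hzh, hzp, hzarms⟩
  · exact absurd rfl hzu
  · exact absurd hz (hzA i)
  refine ⟨fun j hj => ?_, fun i hA => ?_, fun k hk => ?_, fun r' hup => ?_, fun r' hr' he' => ?_⟩
  · obtain ⟨x, hx, y, hxy⟩ := hj
    rw [hpz, Sym2.eq_iff] at hxy
    rcases hxy with ⟨h1, _⟩ | ⟨_, h2⟩
    · rw [← h1] at hx
      exact hb.p_notMem_U r j hx
    · rw [← h2] at hx
      exact hzarms (Or.inl (Or.inl (Set.mem_iUnion.2 ⟨j, hx⟩)))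
  · obtain ⟨x, hx, y, hxy⟩ := hA
    rw [hpz, Sym2.eq_iff] at hxy
    rcases hxy with ⟨h1, _⟩ | ⟨_, h2⟩
    · rw [← h1] at hx
      exact hb.p_notMem_Ah r i hx
    · rw [← h2] at hx
      exact hzA i hx
  · obtain ⟨x, hx, y, hxy⟩ := hk
    rw [hpz, Sym2.eq_iff] at hxy
    rcases hxy with ⟨h1, _⟩ | ⟨_, h2⟩
    · rw [← h1] at hx
      exact hb.p_notMem_F r k hx
    · rw [← h2] at hx
      exact hzarms (Or.inr (Set.mem_iUnion.2 ⟨k, hx⟩))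
  · have hup' : ends e = s(u, p r') := hup
    rw [hpz, Sym2.eq_iff] at hup'
    rcases hup' with ⟨h1, -⟩ | ⟨-, h2⟩
    · exact hb.hne_up r h1.symm
    · exact hzu h2
  · obtain ⟨z', hpz', -, -⟩ := he'
    rw [hpz, Sym2.eq_iff] at hpz'
    rcases hpz' with ⟨h1, -⟩ | ⟨-, h2⟩
    · exact hr' (hb.p_inj h1).symm
    · exact hzp r' h2

end Base

end MixedArms

end Summit.Ventures.PercRepro2
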